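import Summits.HubbardSuperconductivity.HubbardSuperconductivity.Theses.AposterioriCapRg

/-!
# Crux `SeededBrokenRegimeBoseFermiPinned` (item `stmt-HubbardSuperconductivity-14047`): hardness transfer
# and the floor-kills-the-conclusion lemma — support lemmas from the standing disprover (cycle 2)

The crux `[3]` of route AposterioriCapRg reads `∀ kStar etaStar > 0, ∃ Θ, ∀ (U, δ, μ)` in the box with the
density clause, `∀ K Λ L₀, symmetricRegimeCertificateT U μ capRgCornerDataT Θ K Λ L₀ → Concl`,
`Concl := ∃ h₀ > 0, ∃ D, D.MeetsThresholds kStar etaStar ∧ 0 < D.numPatches ∧ 0 < D.meanFieldDensity.fst ∧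
∀ h ∈ (0, h₀], ∃ L₀', D.IsCertifiedEnclosure (hubbardScaleReportCT U μ D h) L₀'` (spelled out below; no named
`Prop` is introduced).  This file records, kernel-checked:

* `capRgPointwise_of_not_seededBrokenRegimeBoseFermiPinned` — **hardness transfer**: any refutation of the
  crux PROVES the pointwise producer `[2′]` ("every tolerance is v3-certified at some point of the box carrying
  the density clause", a weakening of crux `[2]` = `CapRgSymmetricCertificatePinned` with the point depending
  on `Θ`): a refuter must run the CAP at `U ∈ [2,3]` and prove a thermodynamic-limit density theorem.  (If
  `[2′]` fails, some `Θ` is certified nowhere and the crux holds vacuously.)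
* `seededBrokenRegime_concl_mono` — the conclusion is monotone in the thresholds (`0 ≤ kStar' ≤ kStar`,
  `etaStar ≤ etaStar'`), so the crux is equivalent to its restriction to any cofinal family of thresholds.
* `seededBrokenRegime_not_concl_of_datumFloor` — UNCONDITIONAL core of the cycle-2 negative lemma
  (`Negative/SeededBrokenRegimeBoseFermiPinnedFalseOfFloor.lean`): a datum-level remainder floor `c` at a point
  kills the conclusion there for every `kStar ≥ 1` and every rational `etaStar < c`.

Work file with the census and the on-paper findings: `Cruxes/SeededBrokenRegimeBoseFermiPinned/Disproof.lean`.
Sources: folklore (order bookkeeping on the route's records `SymmetricTolerance`, `HubbardScaleData`,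
`hubbardScaleReportCT`); J.-Ll. Figueras, A. Haro, A. Luque, Found. Comput. Math. 17 (2017) Thm. 2.5 for the
a-posteriori format [`FiguerasHaroLuque2016`].
-/

namespace Summit.HubbardSuperconductivity.HubbardSuperconductivity.Theorems.SeededBrokenRegimeBoseFermiPinned.Negative

open Summit.HubbardSuperconductivity.HubbardSuperconductivity.Theses.AposterioriCapRg
open Literature.MathematicalPhysics.QuantumLattice

/-- **Hardness transfer `¬[3] → [2′]`**: a refutation of the crux certifies every tolerance somewhere in
the box, density clause included. [folklore] -/
theorem capRgPointwise_of_not_seededBrokenRegimeBoseFermiPinned (h : ¬ SeededBrokenRegimeBoseFermiPinned)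
    (Θ : SymmetricTolerance) :
    ∃ U ∈ Set.Icc (2:ℝ) 3, ∃ δ ∈ Set.Icc (1/5:ℝ) (7/20), ∃ μ : ℝ,
      Filter.Tendsto (fun L : ℕ => ((hubbardTorusWith 2 (L + 1) 1 U μ).groundStateFunctional
        totalNumber).re / ((L + 1 : ℕ) : ℝ) ^ 2) Filter.atTop (nhds (1 - δ)) ∧
      ∃ (K : TrigPolyC4v) (Λ : ℝ) (L₀ : ℕ), symmetricRegimeCertificateT U μ capRgCornerDataT Θ K Λ L₀ := by
  by_contra hΘ
  refine h fun kStar etaStar _ _ => ⟨Θ, ?_⟩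
  intro U hU δ hδ μ hd K Λ L₀ hc
  exact absurd ⟨U, hU, δ, hδ, μ, hd, K, Λ, L₀, hc⟩ hΘ

/-- **The conclusion of the crux is monotone in the thresholds** (`HubbardScaleData.MeetsThresholds.mono`).
[folklore] -/
theorem seededBrokenRegime_concl_mono {kStar kStar' etaStar etaStar' : ℚ} (hk' : 0 ≤ kStar')
    (hk : kStar' ≤ kStar) (he : etaStar ≤ etaStar') {U μ : ℝ}
    (h : ∃ h₀ : ℝ, 0 < h₀ ∧ ∃ D : HubbardScaleData, D.MeetsThresholds kStar etaStar ∧ 0 < D.numPatches ∧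
      0 < D.meanFieldDensity.fst ∧
      ∀ h ∈ Set.Ioc (0:ℝ) h₀, ∃ L₀' : ℕ, D.IsCertifiedEnclosure (hubbardScaleReportCT U μ D h) L₀') :
    ∃ h₀ : ℝ, 0 < h₀ ∧ ∃ D : HubbardScaleData, D.MeetsThresholds kStar' etaStar' ∧ 0 < D.numPatches ∧
      0 < D.meanFieldDensity.fst ∧
      ∀ h ∈ Set.Ioc (0:ℝ) h₀, ∃ L₀' : ℕ, D.IsCertifiedEnclosure (hubbardScaleReportCT U μ D h) L₀' := by
  obtain ⟨h₀, hh₀, D, hmeets, hNp, hm, hencl⟩ := h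
  exact ⟨h₀, hh₀, D, hmeets.mono hk' hk he, hNp, hm, hencl⟩

/-- **A datum-level remainder floor kills the conclusion** (UNCONDITIONAL): if at `(U, μ)`, for all seeds
below `h₁`, every `h`-uniformly certified datum with a patch (`h₀ ≤ h₁`) has remainder ceiling `≥ c` or fails
the unit stiffness thresholds for every budget, then the conclusion of the crux fails at `(U, μ)` for every
`kStar ≥ 1` and every rational `etaStar < c`. [folklore] -/
theorem seededBrokenRegime_not_concl_of_datumFloor {U μ c h₁ : ℝ} (hh₁ : 0 < h₁)
    (hfl : ∀ (D : HubbardScaleData) (h₀ : ℝ), 0 < h₀ → h₀ ≤ h₁ → 0 < D.numPatches →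
      (∀ h ∈ Set.Ioc (0:ℝ) h₀, ∃ L₀' : ℕ, D.IsCertifiedEnclosure (hubbardScaleReportCT U μ D h) L₀') →
        c ≤ D.remainderNorm.snd ∨ ∀ η : ℚ, ¬ D.MeetsThresholds 1 η)
    {kStar etaStar : ℚ} (hk : 1 ≤ kStar) (he : (etaStar : ℝ) < c) :
    ¬ ∃ h₀ : ℝ, 0 < h₀ ∧ ∃ D : HubbardScaleData, D.MeetsThresholds kStar etaStar ∧ 0 < D.numPatches ∧
        0 < D.meanFieldDensity.fst ∧
        ∀ h ∈ Set.Ioc (0:ℝ) h₀, ∃ L₀' : ℕ, D.IsCertifiedEnclosure (hubbardScaleReportCT U μ D h) L₀' := by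
  rintro ⟨h₀, hh₀, D, hmeets, hNp, -, hencl⟩
  have hmeets1 : D.MeetsThresholds 1 etaStar := hmeets.mono zero_le_one hk le_rfl
  rcases hfl D (min h₀ h₁) (lt_min hh₀ hh₁) (min_le_right _ _) hNp
      (fun h hh => hencl h ⟨hh.1, hh.2.trans (min_le_left _ _)⟩) with hc | hno
  · have h5 : D.remainderNorm.snd ≤ etaStar :=
      (hmeets1 : D.MeetsThresholdsWith 10 1 etaStar).2.2.2.2.2.2.2
    have h5' : ((D.remainderNorm.snd : ℚ) : ℝ) ≤ etaStar := by exact_mod_cast h5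
    linarith
  · exact hno etaStar hmeets1

end Summit.HubbardSuperconductivity.HubbardSuperconductivity.Theorems.SeededBrokenRegimeBoseFermiPinned.Negative
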